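import Summits.ResolutionOfSingularities.ResolutionOfSingularities.Theorems.WeightedInvariantELadderTwoGenSingNonempty
import Summits.ResolutionOfSingularities.ResolutionOfSingularities.Theorems.WeightedInvariantE2HomogeneousShrink
import HarnessLib

/-!
# E-ladder rung `e = 2`: the ORBIT-GENERIC point over a closed point of a unit chart (homogeneous core of the point prime)

[OURS · L1 W4.3 · DOOR `HypersurfaceCentreConstruction` (stmt-ResolutionOfSingularities-19897) · E2 CENTRE piece (C-c), scheme hand
(o47-c-scheme), the orbit-geometry lemma behind (G-1) (cover of `M`) and (M1) (`V(U) ∩ D(h) ⊆ M`) of the registrar's DESIGN MEMO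
`E2-CENTRE-GLUE-DESIGN-v0.md`; written by res-D-pv-048 (gen 11).  Def-free; `--supports` the door item as a helper.  OURS bookkeeping,
NOT a statement of [Hironaka2017]; AI work, weaker than expert review.]

For a CLOSED point `z = i x` of the hypersurface on a UNIT chart `W a` let `P* := core 𝔭_a(z)` be the homogeneous core of its chart prime (the
largest homogeneous ideal inside `𝔭_a(z)`; prime).  The point `η_a(z)` of `W a` with chart prime `P*` («the generic point of the closure of the
torus orbit of `z`») specialises to `z`, lies under every homogeneous ideal contained in `𝔭_a(z)`, and is ORBIT-GENERIC for the stage (on every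
unit chart): it is a maximal point of the fibre of the quotient `q` over the closed point `q x` — the fibre is cut out on `W a` by the homogeneous
fibre ideal `J_a(q x) ⊆ P*` (res-D-pv-031), and a generisation `η'` of `η_a(z)` inside the fibre has `core 𝔭_a(η') = P*` because
`A ⧸ core 𝔭_a(η')` is graded-simple (degree-`0` units from the maximality of `𝔪_{q x}`, homogeneous units from the unit chart; res-type-047's
criterion and `eq_or_eq_top_of_isHomogeneous_of_gradedSimple`) — so `isOrbitGeneric_of_mem_maxPoints_fibre` applies.

* `Stage.gradedSimple_homogeneousCore_of_fibre` — on a unit chart, the homogeneous core of a prime containing the fibre ideal of a closed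
  quotient point has graded-simple quotient;
* `Stage.exists_orbitGeneric_specializes` — the point `η_a(z)`: chart prime `= core 𝔭_a(z)`, `η ⤳ z`, `S.IsOrbitGeneric η`.
-/

noncomputable section

set_option linter.dupNamespace false
set_option backward.isDefEq.respectTransparency false

open CategoryTheory AlgebraicGeometry TopologicalSpace IsLocalRing
open Literature.AlgebraicGeometry.Resolution
open Summit.ResolutionOfSingularities.ResolutionOfSingularities.Theorems
open Summit.ResolutionOfSingularities.ResolutionOfSingularities.Cruxes.HypersurfaceCentreConstruction.LocalEngine

namespace Summit.ResolutionOfSingularities.ResolutionOfSingularities.Theorems.ELadderOne.Stage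

variable {k : Type} [Field k] (S : Stage k)

/-- The point of the affine chart `W a` with a prescribed chart prime. [folklore] -/
theorem exists_primeIdealOf_eq (a : S.atlas.ι) (P : Ideal Γ(S.Y, S.atlas.W a)) (hP : P.IsPrime) :
    ∃ (η : S.Y) (hη : η ∈ (S.atlas.W a : S.Y.Opens)), ((S.atlas.W a).2.primeIdealOf ⟨η, hη⟩).asIdeal = P := by
  set q : PrimeSpectrum Γ(S.Y, S.atlas.W a) := ⟨P, hP⟩ with hq
  have hη : (S.atlas.W a).2.fromSpec q ∈ (S.atlas.W a : S.Y.Opens) := (S.atlas.W a).2.range_fromSpec.le ⟨q, rfl⟩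
  refine ⟨_, hη, ?_⟩
  have h : (S.atlas.W a).2.primeIdealOf ⟨(S.atlas.W a).2.fromSpec q, hη⟩ = q := by
    apply (S.atlas.W a).2.fromSpec.isOpenEmbedding.injective
    rw [IsAffineOpen.fromSpec_primeIdealOf]
  rw [h]

/-- On an affine chart, `η' ⤳ η` iff the chart primes satisfy `𝔭(η') ≤ 𝔭(η)`. [folklore] -/
theorem specializes_iff_primeIdealOf_le (a : S.atlas.ι) {η η' : S.Y} (hη : η ∈ (S.atlas.W a : S.Y.Opens))
    (hη' : η' ∈ (S.atlas.W a : S.Y.Opens)) :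
    η' ⤳ η ↔ ((S.atlas.W a).2.primeIdealOf ⟨η', hη'⟩).asIdeal ≤ ((S.atlas.W a).2.primeIdealOf ⟨η, hη⟩).asIdeal := by
  have key := (S.atlas.W a).2.fromSpec.isOpenEmbedding.isInducing.specializes_iff
    (x := (S.atlas.W a).2.primeIdealOf ⟨η', hη'⟩) (y := (S.atlas.W a).2.primeIdealOf ⟨η, hη⟩)
  rw [IsAffineOpen.fromSpec_primeIdealOf, IsAffineOpen.fromSpec_primeIdealOf] at key
  rw [key, ← PrimeSpectrum.le_iff_specializes, PrimeSpectrum.asIdeal_le_asIdeal]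

/-- **Graded-simplicity of a homogeneous core over a closed quotient point.**  On a UNIT chart `W a`, let `v` be a CLOSED point of the
quotient and `Q ⊆ Γ(Y, W a)` a prime ideal containing the fibre ideal `J_a(v)`.  Then the homogeneous core `Q* := core Q` (prime,
homogeneous, `⊇ J_a(v)`) has GRADED-SIMPLE quotient: degree-`0` sections off `Q*` are units modulo `Q*` (`𝔪_v` is maximal;
`isUnit_quotient_mk_of_degreeZero_of_fibreIdeal_le`), and the unit chart supplies homogeneous units in all degrees `e • χ` (the point of `Q*`
lies on `i(X)`), so res-type-047's criterion applies. [folklore] -/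
theorem gradedSimple_homogeneousCore_of_fibre {a : S.atlas.ι} (ha : S.IsUnitChart a) {v : S.V}
    (hv : v ∈ (S.atlas.U a : S.V.Opens)) (hvc : IsClosed ({v} : Set S.V)) {Q : Ideal Γ(S.Y, S.atlas.W a)} (hQ : Q.IsPrime)
    (hJQ : S.fibreIdeal a hv ≤ Q) :
    letI := S.atlas.gradedRing a
    ∀ (d : Fin S.j → ℤ) ⦃x : Γ(S.Y, S.atlas.W a)⦄, x ∈ S.atlas.piece a d →
      x ∉ (Q.homogeneousCore (S.atlas.piece a)).toIdeal →
        IsUnit (Ideal.Quotient.mk (Q.homogeneousCore (S.atlas.piece a)).toIdeal x) := by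
  classical
  letI := S.atlas.gradedRing a
  set Qc := (Q.homogeneousCore (S.atlas.piece a)).toIdeal with hQc
  haveI hQcp : Qc.IsPrime := E2Model.isPrime_homogeneousCore (S.atlas.piece a) hQ
  -- `J_a(v) ≤ Q*` (the fibre ideal is homogeneous)
  have hJQc : S.fibreIdeal a hv ≤ Qc :=
    (S.isHomogeneous_fibreIdeal a hv).toIdeal_homogeneousCore_eq_self.symm.trans_le
      (Ideal.homogeneousCore_mono (S.atlas.piece a) hJQ)
  -- the point of `Q*` lies on `i(X)` (`I(X)(W a) ≤ J_a(v) ≤ Q*`)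
  obtain ⟨η, hη, hηQ⟩ := S.exists_primeIdealOf_eq a Qc hQcp
  have hηX : η ∈ Set.range S.i.base :=
    S.mem_range_of_ker_ideal_le a hη (by rw [hηQ]; exact (S.ker_ideal_le_fibreIdeal a hv).trans hJQc)
  -- degree-`0` units and chart units modulo `Q*`
  have h0 : ∀ ⦃s : Γ(S.Y, S.atlas.W a)⦄, s ∈ S.atlas.piece a 0 → s ∉ Qc → IsUnit (Ideal.Quotient.mk Qc s) :=
    fun s hs0 hsQ => S.isUnit_quotient_mk_of_degreeZero_of_fibreIdeal_le a hv hvc hJQc hs0 hsQ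
  have hu : ∀ χ : Fin S.j → ℤ, ∃ u ∈ S.atlas.piece a (S.atlas.exponent • χ), IsUnit (Ideal.Quotient.mk Qc u) := by
    intro χ
    obtain ⟨u, hu, hunit⟩ := S.exists_isUnit_quotient_of_isUnitChart ha hη hηX χ
    rw [hηQ] at hunit
    exact ⟨u, hu, hunit⟩
  exact gradedSimple_of_degreeZero_of_units (S.atlas.piece a) h0 (Nat.pos_iff_ne_zero.mp S.atlas.exponent_pos) hu

/-- **THE ORBIT-GENERIC POINT OVER A CLOSED POINT.**  On a unit chart `W a`, for a CLOSED point `z = i x` of the hypersurface there is a point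
`η ∈ W a` whose chart prime is the homogeneous core `core 𝔭_a(z)`; it specialises to `z` and is ORBIT-GENERIC for the stage (a maximal point
of the fibre of `q` over the closed point `q x`; res-D-pv-031's `isOrbitGeneric_of_mem_maxPoints_fibre`). [folklore] -/
theorem exists_orbitGeneric_specializes {a : S.atlas.ι} (ha : S.IsUnitChart a) {x : S.X}
    (hz : S.i.base x ∈ (S.atlas.W a : S.Y.Opens)) (hzc : IsClosed ({S.i.base x} : Set S.Y)) :
    ∃ (η : S.Y) (hη : η ∈ (S.atlas.W a : S.Y.Opens)),
      letI := S.atlas.gradedRing a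
      ((S.atlas.W a).2.primeIdealOf ⟨η, hη⟩).asIdeal =
          (((S.atlas.W a).2.primeIdealOf ⟨S.i.base x, hz⟩).asIdeal.homogeneousCore (S.atlas.piece a)).toIdeal ∧
        η ⤳ S.i.base x ∧ S.IsOrbitGeneric η := by
  classical
  letI := S.atlas.gradedRing a
  set Pz := ((S.atlas.W a).2.primeIdealOf ⟨S.i.base x, hz⟩).asIdeal with hPz
  set P := (Pz.homogeneousCore (S.atlas.piece a)).toIdeal with hP
  haveI hPp : P.IsPrime := E2Model.isPrime_homogeneousCore (S.atlas.piece a) ((S.atlas.W a).2.primeIdealOf ⟨S.i.base x, hz⟩).2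
  have hPhom : P.IsHomogeneous (S.atlas.piece a) := (Pz.homogeneousCore (S.atlas.piece a)).isHomogeneous
  have hPle : P ≤ Pz := Ideal.toIdeal_homogeneousCore_le _ _
  obtain ⟨η, hη, hηP⟩ := S.exists_primeIdealOf_eq a P hPp
  refine ⟨η, hη, hηP, ?_, ?_⟩
  · -- `η ⤳ z`
    rw [S.specializes_iff_primeIdealOf_le a hz hη, hηP]
    exact hPle
  · -- `η` is a maximal point of the fibre of `q` over the closed point `v := q x`
    -- the closed point of the quotient
    have hxc : IsClosed ({x} : Set S.X) := by
      have h := hzc.preimage S.i.continuous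
      have e : S.i.base ⁻¹' {S.i.base x} = {x} := by
        ext x'
        simp only [Set.mem_preimage, Set.mem_singleton_iff]
        exact S.i.isClosedEmbedding.injective.eq_iff
      rwa [e] at h
    set v := S.q.base x with hv'
    have hvc : IsClosed ({v} : Set S.V) := S.isClosed_singleton_q hxc
    have hv : v ∈ (S.atlas.U a : S.V.Opens) := S.base_mem_U a hz
    -- the fibre ideal lies in `𝔭(z)`, hence (homogeneous) in its core `P = 𝔭(η)`
    have hJz : S.fibreIdeal a hv ≤ Pz := (S.fibreIdeal_le_primeIdealOf_iff a hv hvc hz).mpr rfl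
    have hJP : S.fibreIdeal a hv ≤ P :=
      (S.isHomogeneous_fibreIdeal a hv).toIdeal_homogeneousCore_eq_self.symm.trans_le
        (Ideal.homogeneousCore_mono (S.atlas.piece a) hJz)
    refine S.isOrbitGeneric_of_mem_maxPoints_fibre hvc ⟨?_, fun η' hη'F hsp => ?_⟩
    · -- `η` lies in the fibre: it is on `i(X)` and its point of `X` maps to `v`
      obtain ⟨x₁, hx₁⟩ := S.mem_range_of_ker_ideal_le a hη (by rw [hηP]; exact (S.ker_ideal_le_fibreIdeal a hv).trans hJP)
      refine ⟨x₁, ?_, hx₁⟩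
      have hx₁W : S.i.base x₁ ∈ (S.atlas.W a : S.Y.Opens) := hx₁ ▸ hη
      have h1 : S.fibreIdeal a hv ≤ ((S.atlas.W a).2.primeIdealOf ⟨S.i.base x₁, hx₁W⟩).asIdeal := by
        have e : (⟨S.i.base x₁, hx₁W⟩ : (S.atlas.W a : S.Y.Opens)) = ⟨η, hη⟩ := Subtype.ext hx₁
        rw [e, hηP]
        exact hJP
      exact (S.fibreIdeal_le_primeIdealOf_iff a hv hvc hx₁W).mp h1
    · -- maximality: a generisation `η'` of `η` inside the fibre is `η`
      have hη'W : η' ∈ (S.atlas.W a : S.Y.Opens) := hsp.mem_open (S.atlas.W a : S.Y.Opens).2 hη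
      set Q := ((S.atlas.W a).2.primeIdealOf ⟨η', hη'W⟩).asIdeal with hQ
      have hQP : Q ≤ P := by rw [← hηP]; exact (S.specializes_iff_primeIdealOf_le a hη hη'W).mp hsp
      -- `η'` lies over `v`, so `J_a(v) ≤ Q`
      obtain ⟨x', hx'v, hx'⟩ := hη'F
      have hx'W : S.i.base x' ∈ (S.atlas.W a : S.Y.Opens) := hx' ▸ hη'W
      have hJQ : S.fibreIdeal a hv ≤ Q := by
        have h1 := (S.fibreIdeal_le_primeIdealOf_iff a hv hvc hx'W).mpr hx'v
        have e : (⟨S.i.base x', hx'W⟩ : (S.atlas.W a : S.Y.Opens)) = ⟨η', hη'W⟩ := Subtype.ext hx'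
        rwa [e] at h1
      -- the core of `Q` has graded-simple quotient and lies in the homogeneous prime `P`: it is `P`
      set Qc := (Q.homogeneousCore (S.atlas.piece a)).toIdeal with hQc
      have hQcQ : Qc ≤ Q := Ideal.toIdeal_homogeneousCore_le _ _
      have hgs := S.gradedSimple_homogeneousCore_of_fibre ha hv hvc ((S.atlas.W a).2.primeIdealOf ⟨η', hη'W⟩).2 hJQ
      rcases eq_or_eq_top_of_isHomogeneous_of_gradedSimple (S.atlas.piece a) hgs hPhom (hQcQ.trans hQP) with hPQ | hPtop
      · -- `P = Q*`, so `Q = P` and `η' = η`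
        have hQeq : Q = P := le_antisymm hQP (hPQ ▸ hQcQ)
        have hpt : (S.atlas.W a).2.primeIdealOf ⟨η', hη'W⟩ = (S.atlas.W a).2.primeIdealOf ⟨η, hη⟩ :=
          PrimeSpectrum.ext (hQeq.trans hηP.symm)
        have h1 := congrArg (fun q => ((S.atlas.W a).2.fromSpec q : S.Y)) hpt
        simp only [IsAffineOpen.fromSpec_primeIdealOf] at h1
        exact h1
      · exact absurd hPtop hPp.ne_top

end Summit.ResolutionOfSingularities.ResolutionOfSingularities.Theorems.ELadderOne.Stage

end
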